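import Mathlib
import Summits.Ventures.PercRepro.TriangleCapFourBelowResidueB

/-!
# PercRepro — THE ONE-TRIANGLE RESIDUE AT `r = 4` ON THE CELLS `m = 3k − 13` FOR `k ≥ 12` (p3, gen 39; part 139)

The residue of part 130 with `k ≥ 12` in place of `k ≥ 13`: the same case analysis (its arithmetic never used
`n ≥ 10`), covering the cell `(12, 23)`.  Axioms: standard.
-/

namespace PercRepro

namespace TriangleCap

namespace C047

open Finset

variable {V : Type*} [Fintype V] [DecidableEq V]

set_option maxHeartbeats 1000000 in
/-- **THE ONE-TRIANGLE RESIDUE ON THE CELLS `m = 3k − 13`, `k ≥ 13`:** `u`'s private set the largest, every degree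
`≥ 2`, at most four outer vertices ⇒ `Σ_v d(v)² + 4 (k − 5) ≤ m k`. -/
theorem one_triangle_residue_three_twelve (D : SimpleGraph V) [DecidableRel D.Adj] (hK : K4mFree D)
    {u v w : V} (huv : D.Adj u v) (huw : D.Adj u w) (hvw : D.Adj v w)
    (hT : ∀ a b c, D.Adj a b → D.Adj a c → D.Adj b c → a = u ∨ a = v ∨ a = w) (hk : 12 ≤ Fintype.card V)
    (hdeg : ∀ z, 2 ≤ deg D z)
    (hmv : degIn D ({u, v, w} : Finset V)ᶜ v ≤ degIn D ({u, v, w} : Finset V)ᶜ u)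
    (hmw : degIn D ({u, v, w} : Finset V)ᶜ w ≤ degIn D ({u, v, w} : Finset V)ᶜ u)
    (hm : D.edgeFinset.card + 13 = 3 * Fintype.card V)
    (hq : ((({u, v, w} : Finset V)ᶜ).filter (fun z => degIn D {u, v, w} z = 0)).card ≤ 4) :
    ∑ v, deg D v * deg D v + 4 * (Fintype.card V - 5) ≤ D.edgeFinset.card * Fintype.card V := by
  apply one_triangle_stability_four_of_private D hK huv huw hvw hT (by omega)
  set S : Finset V := {u, v, w} with hS
  set P : Finset V := Sᶜ.filter (fun x => D.Adj u x) with hP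
  set Q : Finset V := Sᶜ.filter (fun z => degIn D S z = 0) with hQ
  clear_value S P Q
  have h3 : S.card = 3 := by rw [hS]; exact card_triple huv.ne huw.ne hvw.ne
  have hcl : ∀ x ∈ S, ∀ y ∈ S, x ≠ y → D.Adj x y := by rw [hS]; exact clique_triple D huv huw hvw
  have hone : ∀ z ∈ Sᶜ, degIn D S z ≤ 1 := fun z hz => by
    rw [hS] at hz ⊢; exact degIn_le_one_of_triangle D hK huv huw hvw (mem_compl.mp hz)
  have hnotri : ∀ y ∈ Sᶜ, ∀ y' ∈ Sᶜ, ∀ t ∈ Sᶜ, D.Adj y y' → D.Adj y t → D.Adj y' t → False := by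
    intro y hy y' _ t _ hyy' hyt _
    rw [mem_compl, hS] at hy
    simp only [mem_insert, mem_singleton, not_or] at hy
    rcases hT y y' t hyy' hyt (by assumption) with h | h | h
    · exact hy.1 h
    · exact hy.2.1 h
    · exact hy.2.2 h
  have hPS : P ⊆ Sᶜ := by rw [hP]; exact filter_subset _ _
  have hPind : ∀ x ∈ P, ∀ x' ∈ P, ¬ D.Adj x x' := by rw [hP, hS]; exact priv_indep D hT
  have hQR : Q ⊆ Sᶜ \ P := by
    intro z hz
    rw [hQ, mem_filter] at hz
    rw [mem_sdiff, hP, mem_filter]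
    refine ⟨hz.1, fun h => ?_⟩
    have : 1 ≤ degIn D S z := by
      unfold degIn
      apply card_pos.mpr
      exact ⟨u, mem_filter.mpr ⟨by rw [hS]; exact mem_insert_self _ _, h.2.symm⟩⟩
    omega
  -- the numbers
  have hn : Fintype.card V = Sᶜ.card + 3 := by
    rw [card_compl, h3]
    have : S.card ≤ Fintype.card V := card_le_univ _
    rw [h3] at this
    omega
  have ht : P.card = degIn D Sᶜ u := by rw [hP]; exact card_priv_eq D S u
  have hp := sum_private_eq D huv huw hvw
  have hσ := sigma_eq_split D huv huw hvw
  rw [← hS] at hp hσ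
  have hsum_s : ∑ z ∈ Sᶜ, degIn D S z + Q.card = Sᶜ.card := by
    have hc := card_filter_add_card_filter_not (fun z => degIn D S z = 0) (s := Sᶜ)
    have h1 : ∑ z ∈ Sᶜ, degIn D S z = (Sᶜ.filter (fun z => ¬ degIn D S z = 0)).card := by
      rw [card_eq_sum_ones, sum_filter]
      apply sum_congr rfl
      intro z hz
      have := hone z hz
      by_cases h0 : degIn D S z = 0
      · simp only [h0, not_true_eq_false, if_false]
      · simp only [h0, not_false_eq_true, if_true]; omega
    rw [hQ]
    omega
  have hcomm := sum_degIn_comm D S Sᶜ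
  have hdens := two_mul_card_edges_eq_adjPairs_add D S
  have hQ6 : adjPairs D S = 6 := by
    rw [adjPairs_eq_sum_degIn]
    calc ∑ x ∈ S, degIn D S x = ∑ _x ∈ S, 2 := sum_congr rfl (fun x hx => degIn_self_of_clique D h3 hcl hx)
      _ = 6 := by rw [sum_const, h3, smul_eq_mul]
  rw [hQ6] at hdens
  have hsplitR := sum_degIn_compl_split D S P hPS hPind
  have hRcard : (Sᶜ \ P).card + P.card = Sᶜ.card := card_sdiff_add_card_eq_card hPS
  have hYcard : ((Sᶜ \ P) \ Q).card + Q.card = (Sᶜ \ P).card := card_sdiff_add_card_eq_card hQR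
  have hsR : ∑ y ∈ Sᶜ \ P, degIn D P y = ∑ y ∈ (Sᶜ \ P) \ Q, degIn D P y + ∑ z ∈ Q, degIn D P z :=
    (sum_sdiff hQR).symm
  have hsY := sum_degIn_le_card_mul D P ((Sᶜ \ P) \ Q)
  have hDout := sum_outer_degIn_split D S P Q hPS
  have hdQ := sum_degIn_R_le D (Sᶜ \ P) Q hQR
  have houter := two_mul_card_outer_le_sum D S hdeg
  have hBC : ∑ y ∈ Sᶜ \ P, degIn D P y * degIn D P y ≤ ∑ y ∈ Sᶜ \ P, degIn D P y * P.card :=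
    sum_le_sum (fun y _ => Nat.mul_le_mul_left _ (degIn_le_card D P y))
  have hBeq : ∑ y ∈ Sᶜ \ P, degIn D P y * P.card = (∑ y ∈ Sᶜ \ P, degIn D P y) * P.card := by
    rw [sum_mul]
  -- abbreviations
  rw [← hS, ← hP, ← hQ] at *
  rw [hBeq]
  obtain ⟨n, hn'⟩ : ∃ n, Sᶜ.card = n := ⟨_, rfl⟩
  obtain ⟨t, ht'⟩ : ∃ t, degIn D Sᶜ u = t := ⟨_, rfl⟩
  obtain ⟨tv, htv'⟩ : ∃ tv, degIn D Sᶜ v = tv := ⟨_, rfl⟩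
  obtain ⟨tw, htw'⟩ : ∃ tw, degIn D Sᶜ w = tw := ⟨_, rfl⟩
  obtain ⟨q, hq'⟩ : ∃ q, Q.card = q := ⟨_, rfl⟩
  obtain ⟨m, hm'⟩ : ∃ m, D.edgeFinset.card = m := ⟨_, rfl⟩
  obtain ⟨σ, hσ'⟩ : ∃ σ, ∑ x ∈ S, degIn D Sᶜ x * degIn D Sᶜ x = σ := ⟨_, rfl⟩
  obtain ⟨sR, hsR'⟩ : ∃ sR, ∑ y ∈ Sᶜ \ P, degIn D P y = sR := ⟨_, rfl⟩
  obtain ⟨sY, hsY'⟩ : ∃ sY, ∑ y ∈ (Sᶜ \ P) \ Q, degIn D P y = sY := ⟨_, rfl⟩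
  obtain ⟨sQ, hsQ'⟩ : ∃ sQ, ∑ z ∈ Q, degIn D P z = sQ := ⟨_, rfl⟩
  obtain ⟨qR, hqR'⟩ : ∃ qR, ∑ y ∈ Sᶜ \ P, degIn D (Sᶜ \ P) y = qR := ⟨_, rfl⟩
  obtain ⟨dQ, hdQ'⟩ : ∃ dQ, ∑ z ∈ Q, degIn D (Sᶜ \ P) z = dQ := ⟨_, rfl⟩
  obtain ⟨Dout, hDout'⟩ : ∃ Dout, ∑ z ∈ Q, degIn D Sᶜ z = Dout := ⟨_, rfl⟩
  obtain ⟨C, hC'⟩ : ∃ C, ∑ y ∈ Sᶜ \ P, degIn D P y * degIn D P y = C := ⟨_, rfl⟩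
  obtain ⟨r, hr'⟩ : ∃ r, ((Sᶜ \ P) \ Q).card = r := ⟨_, rfl⟩
  obtain ⟨Rc, hRc'⟩ : ∃ Rc, (Sᶜ \ P).card = Rc := ⟨_, rfl⟩
  rw [hn'] at hn hsum_s hRcard
  rw [ht'] at ht hmv hmw
  rw [htv'] at hmv hp hσ
  rw [htw'] at hmw hp hσ
  rw [ht'] at hp hσ
  rw [hq'] at hsum_s hYcard houter
  rw [hm'] at hdens hm
  rw [hσ'] at hσ
  rw [hsR'] at hsplitR hsR
  rw [hsY', hsQ'] at hsR
  rw [hsY', hr', ht] at hsY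
  rw [hsQ', hdQ', hDout'] at hDout
  rw [hqR', hdQ', hr'] at hdQ
  rw [hDout'] at houter
  rw [hqR'] at hsplitR
  rw [hBeq, hC', hsR', ht] at hBC
  rw [hr', hRc'] at hYcard
  rw [hRc'] at hRcard
  rw [hn', hσ', hq', hm', hsR', hDout', hC', ht]
  rw [hcomm] at hp
  have hp' : n = t + tv + tw + q := by omega
  clear hp
  -- the facts, in numbers:
  -- hn : k = n + 3; hp : n − q = t + tv + tw; hσ : σ ≤ t² + (tv + tw)²; hdens : 2m = 6 + 2(n − q) + 2 sR + qR;
  -- hsR : sR = sY + sQ; hsY : sY ≤ r t; hDout : Dout = sQ + dQ; hdQ : qR ≤ 2 dQ + r (r − 1); houter : 2q ≤ Dout;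
  -- hBC : C ≤ sR t; hRcard : Rc + t = n; hYcard : r + q = Rc; hmv, hmw : tv, tw ≤ t; hm : m + 13 = 3 (n + 3)
  rw [hn] at hm hk
  have hk10 : 9 ≤ n := by omega
  have hr : r = tv + tw := by omega
  subst hr
  have hRc : Rc = tv + tw + q := by omega
  subst hRc
  subst hp'
  have hmval : m = 3 * (t + tv + tw + q) - 4 := by omega
  subst hmval
  rcases Nat.eq_zero_or_pos q with hq0 | hq1
  · -- NO OUTER VERTEX
    subst hq0
    have hQe : Q = ∅ := card_eq_zero.mp hq'
    have hsQ0 : sQ = 0 := by rw [← hsQ', hQe, sum_empty]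
    have hdQ0 : dQ = 0 := by rw [← hdQ', hQe, sum_empty]
    have hDout0 : Dout = 0 := by rw [← hDout', hQe, sum_empty]
    have hYR : (Sᶜ \ P) \ Q = Sᶜ \ P := by rw [hQe, sdiff_empty]
    rcases Nat.lt_or_ge (tv + tw) 2 with hr1 | hr2
    · -- `r ≤ 1`: not dense
      exfalso
      have hsRle : sR ≤ (tv + tw) * t := by linarith
      have hqRle : qR ≤ (tv + tw) * (tv + tw - 1) := by
        rw [← hqR']
        calc ∑ y ∈ Sᶜ \ P, degIn D (Sᶜ \ P) y ≤ ∑ _y ∈ Sᶜ \ P, ((Sᶜ \ P).card - 1) :=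
              sum_le_sum (fun y hy => degIn_le_card_sub_one D hy)
          _ = (tv + tw) * (tv + tw - 1) := by rw [sum_const, smul_eq_mul, hRc', add_zero]
      interval_cases hvtw : (tv + tw) <;> omega
    rcases Nat.lt_or_ge (tv + tw) 3 with hr2' | hr3
    · -- `r = 2`: the two private vertices of `v` and `w`
      have hr2e : tv + tw = 2 := by omega
      obtain ⟨y₁, y₂, hne, hY⟩ := card_eq_two.mp (by rw [hr']; exact hr2e)
      have hy₁ : y₁ ∈ (Sᶜ \ P) \ Q := by rw [hY]; exact mem_insert_self _ _
      have hy₂ : y₂ ∈ (Sᶜ \ P) \ Q := by rw [hY]; exact mem_insert_of_mem (mem_singleton_self _)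
      rw [hYR] at hY hy₁ hy₂
      have hsum2 : sR = degIn D P y₁ + degIn D P y₂ := by
        rw [← hsR', hY, sum_pair hne]
      have hC2 : C = degIn D P y₁ * degIn D P y₁ + degIn D P y₂ * degIn D P y₂ := by
        rw [← hC', hY, sum_pair hne]
      have hqR2 : qR = degIn D {y₁, y₂} y₁ + degIn D {y₁, y₂} y₂ := by
        rw [← hqR', hY, sum_pair hne]
      have ha₁ : degIn D P y₁ ≤ t := by rw [← ht]; exact degIn_le_card D P y₁
      have ha₂ : degIn D P y₂ ≤ t := by rw [← ht]; exact degIn_le_card D P y₂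
      -- not adjacent: else `a₁ + a₂ ≤ t` and the density fails
      have hnadj : ¬ D.Adj y₁ y₂ := by
        intro hadj
        have := degIn_add_degIn_le_of_adj D S P hPS hnotri (sdiff_subset hy₁) (sdiff_subset hy₂) hadj
        rw [ht] at this
        have hqRb : qR ≤ 2 := by
          rw [hqR2]
          have h1 : degIn D {y₁, y₂} y₁ ≤ 1 := by
            unfold degIn
            have : ({y₁, y₂} : Finset V).filter (fun y => D.Adj y₁ y) ⊆ {y₂} := by
              intro y hy
              rw [mem_filter, mem_insert, mem_singleton] at hy
              rw [mem_singleton]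
              rcases hy.1 with h | h
              · exact absurd (h ▸ hy.2) D.irrefl
              · exact h
            have := card_le_card this
            rwa [card_singleton] at this
          have h2 : degIn D {y₁, y₂} y₂ ≤ 1 := by
            unfold degIn
            have : ({y₁, y₂} : Finset V).filter (fun y => D.Adj y₂ y) ⊆ {y₁} := by
              intro y hy
              rw [mem_filter, mem_insert, mem_singleton] at hy
              rw [mem_singleton]
              rcases hy.1 with h | h
              · exact h
              · exact absurd (h ▸ hy.2) D.irrefl
            have := card_le_card this
            rwa [card_singleton] at this
          omega
        omega
      have hqR0 : qR = 0 := by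
        rw [hqR2]
        have h1 : degIn D {y₁, y₂} y₁ = 0 := by
          unfold degIn
          rw [card_eq_zero, filter_eq_empty_iff]
          intro y hy
          rw [mem_insert, mem_singleton] at hy
          rcases hy with h | h
          · subst h; exact D.irrefl
          · subst h; exact hnadj
        have h2 : degIn D {y₁, y₂} y₂ = 0 := by
          unfold degIn
          rw [card_eq_zero, filter_eq_empty_iff]
          intro y hy
          rw [mem_insert, mem_singleton] at hy
          rcases hy with h | h
          · subst h; exact fun h' => hnadj h'.symm
          · subst h; exact D.irrefl
        omega
      have hs : sR = 2 * (t + 2) - 7 := by omega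
      have hlow := two_terms_lower (degIn D P y₁) (degIn D P y₂) t ha₁ ha₂ (by omega)
      have hAP : (degIn D P y₁ + degIn D P y₂ - t) * (2 * t - (degIn D P y₁ + degIn D P y₂)) + C ≤ sR * t := by
        rw [hC2, hsum2, add_mul]
        have e1 : degIn D P y₁ * (t - degIn D P y₁) + degIn D P y₁ * degIn D P y₁ = degIn D P y₁ * t := by
          rw [← mul_add, Nat.sub_add_cancel ha₁]
        have e2 : degIn D P y₂ * (t - degIn D P y₂) + degIn D P y₂ * degIn D P y₂ = degIn D P y₂ * t := by
          rw [← mul_add, Nat.sub_add_cancel ha₂]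
        linarith [hlow, e1, e2]
      rw [← hsum2] at hAP
      have hrw1 : sR - t = t - 3 := by omega
      have hrw2 : 2 * t - sR = 3 := by omega
      rw [hrw1, hrw2] at hAP
      have hσ2 : σ ≤ t * t + 4 := by
        have : tv ≤ 2 := by omega
        have : tw ≤ 2 := by omega
        interval_cases tv <;> interval_cases tw <;> omega
      have ht7 : 7 ≤ t := by omega
      have e3 : 3 * (t + tv + tw + 0) - 4 = 3 * t + 2 := by omega
      rw [e3, hDout0]
      obtain ⟨t', rfl⟩ : ∃ t', t = t' + 7 := ⟨t - 7, by omega⟩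
      have e4 : (t' + 7 - 3) * 3 = 3 * t' + 12 := by omega
      rw [e4] at hAP
      clear hsR' hsY' hsQ' hqR' hdQ' hDout' hC' hn' ht' htv' htw' hq' hm' hσ' hr' hRc' hY hy₁ hy₂ hsum2 hC2 hqR2
        hlow hsplitR hdens hsR hsY hDout hdQ houter hBC hBeq hYcard hRcard hmv hmw hsum_s hcomm hnotri hone
        hPind hPS hQR hnadj hqR0 ha₁ ha₂ hQe hsQ0 hdQ0 hDout0 hYR hq hT hdeg hK hcl h3 hσ hs hrw1 hrw2 ht hS hP hQ
        hne huv huw hvw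
      have e5 : t' + 7 + tv + tw + 0 = t' + 9 := by omega
      rw [e5]
      clear hr2e hk hn hk10 hm e3 e4 ht7 hQ6 hr2 hr2'
      nlinarith [hσ2, hAP]
    · -- `r ≥ 3`: nothing needed beyond `σ`
      have ht3 : 3 ≤ t := by omega
      have e3 : 3 * (t + tv + tw + 0) - 4 = 3 * (t + tv + tw) - 4 := by omega
      rw [e3]
      clear hsR' hsY' hsQ' hqR' hdQ' hDout' hC' hn' ht' htv' htw' hq' hm' hσ' hr' hRc' hsplitR hdens hsR hsY
        hDout hdQ houter hBeq hYcard hRcard hmv hmw hsum_s hcomm hnotri hone hPind hPS hQR hQe hsQ0 hdQ0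
        hYR hq hT hdeg hK hcl h3 hS hP hQ huv huw hvw hk hn hk10 hm e3
      have hkey : 5 * (t + tv + tw) ≤ 2 * (t * (tv + tw)) + 2 * (tv * tw) + 12 := by
        nlinarith [Nat.mul_le_mul ht3 hr3]
      rw [hDout0]
      have hm3 : 3 * (t + tv + tw) - 4 + 4 = 3 * (t + tv + tw) := by omega
      obtain ⟨m3, hm3'⟩ : ∃ m3, 3 * (t + tv + tw) - 4 = m3 := ⟨_, rfl⟩
      rw [hm3'] at hm3 ⊢
      ring_nf at hσ hBC hkey hm3 ⊢
      linarith [hσ, hBC, hkey, hm3]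
  · -- AT LEAST ONE OUTER VERTEX
    rw [hq'] at hq
    rcases Nat.lt_or_ge (tv + tw) 2 with hr1 | hr2
    · -- `r ≤ 1`: the exact outer degrees
      have hvtw1 : tv + tw ≤ 1 := by omega
      have htv1 : tv ≤ 1 := by omega
      have htw1 : tw ≤ 1 := by omega
      have hq4 : q ≤ 4 := hq
      have hdQge : qR ≤ 2 * dQ := by
        have : (tv + tw) * (tv + tw - 1) = 0 := by
          rcases Nat.le_one_iff_eq_zero_or_eq_one.mp hvtw1 with h | h <;> rw [h]
        omega
      have hmain : 4 * (t + tv + tw + q) + 2 * q ≤ 2 * Dout + 2 * ((tv + tw) * t) + 14 := by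
        have h1 : 2 * D.edgeFinset.card = 2 * (3 * (t + tv + tw + q) - 4) := by rw [hm']
        have h2 : 2 * (3 * (t + tv + tw + q) - 4) + 8 = 6 * (t + tv + tw + q) := by omega
        linarith [hdens, hsplitR, hsR, hsY, hDout, hdQge, h1, h2]
      clear hsR' hsY' hsQ' hqR' hdQ' hDout' hC' hn' ht' htv' htw' hq' hm' hσ' hr' hRc' hsplitR hdens hsR hsY
        hDout hdQ houter hBeq hYcard hRcard hmv hmw hsum_s hcomm hnotri hone hPind hPS hQR hq hT hdeg hK hcl h3
        hS hP hQ huv huw hvw hk hn hm hdQge hQ6 hr1 hvtw1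
      have hm3 : 3 * (t + tv + tw + q) - 4 + 4 = 3 * (t + tv + tw + q) := by omega
      clear hk10
      obtain ⟨m3, hm3'⟩ : ∃ m3, 3 * (t + tv + tw + q) - 4 = m3 := ⟨_, rfl⟩
      rw [hm3'] at hm3 ⊢
      interval_cases tv <;> interval_cases tw <;> interval_cases q <;> (ring_nf at hσ hBC hmain hm3 ⊢; linarith)
    · -- `r ≥ 2`: the crude count
      have ht2 : 2 ≤ t := by omega
      have hq4 : q ≤ 4 := hq
      have hkey : 5 * (t + tv + tw + q) + q * q ≤
          2 * (t * (tv + tw)) + 2 * (tv * tw) + 5 * q + q * (t + tv + tw + q) + 12 := by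
        clear hsR' hsY' hsQ' hqR' hdQ' hDout' hC' hn' ht' htv' htw' hq' hm' hσ' hr' hRc' hsplitR hdens hsR hsY
          hDout hdQ houter hBeq hYcard hRcard hmv hmw hsum_s hcomm hnotri hone hPind hPS hQR hq hT hdeg hK hcl h3
          hS hP hQ huv huw hvw hσ hBC hk hn hm hk10
        interval_cases q <;> nlinarith [Nat.mul_le_mul ht2 hr2]
      clear hsR' hsY' hsQ' hqR' hdQ' hDout' hC' hn' ht' htv' htw' hq' hm' hσ' hr' hRc' hsplitR hdens hsR hsY
        hDout hdQ hBeq hYcard hRcard hmv hmw hsum_s hcomm hnotri hone hPind hPS hQR hq hT hdeg hK hcl h3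
        hS hP hQ huv huw hvw
      have hm3 : 3 * (t + tv + tw + q) - 4 + 4 = 3 * (t + tv + tw + q) := by omega
      obtain ⟨m3, hm3'⟩ : ∃ m3, 3 * (t + tv + tw + q) - 4 = m3 := ⟨_, rfl⟩
      rw [hm3'] at hm3 ⊢
      ring_nf at hσ hBC hkey houter hm3 ⊢
      linarith [hσ, hBC, hkey, houter, hm3]


end C047

end TriangleCap

end PercRepro
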